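import Summits.ResolutionOfSingularities.ResolutionOfSingularities.Theorems.WildConesClassicalRegimesDefs
import Summits.ResolutionOfSingularities.ResolutionOfSingularities.Theorems.WildConesClassicalRegimesStubOrdPExitSurface
import Summits.ResolutionOfSingularities.ResolutionOfSingularities.Theorems.WildConesClassicalRegimesStubHighOrdNotIsol

/-!
# Route `JacobianBudget`, crux `IsolatedJacobianDrop` (stmt-ResolutionOfSingularities-18946), line
# `euler-noether`: stub `stub_eulerTransform` (S3) — the Euler transform identity

For the point-blow-up dynamics of the height-one atom `z ^ p = a(u₁, …, uₙ)` in characteristic `p`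
named in `Theorems/WildConesClassicalRegimesDefs.lean` (`clean`, `bl`, `dv`, `tr`, `step`, `ser`,
`pd`, `MultP`), we prove the FIRST LEMMA of the line: for a state `c` of multiplicity `p`
(`MultP p n L c`) and the AXIS successor of chart `i` (translation `τ = 0`),

* for `j ≠ i`, the `j`-th partial of the successor's series is the `(p-1)`-controlled transform
  `dv i (p-1) ∘ bl i` of the coefficient function of `∂_j a` (`a = ser c`, the cleaned series);
* the `i`-th partial of the successor's series is the `(p+1)`-controlled transform
  `dv i (p+1) ∘ bl i` of the coefficient function of the Euler derivative `θa = Σ_j u_j ∂_j a`.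

Argument (pure coefficient bookkeeping, the lead's hand computation). Under `MultP` the division
exponent of `step` is `p` (`WildCones.OrdPExitSurface.step_eq`); the zero translation is the identity
(`tr_zero`); cleaning is idempotent (`clean_clean`); so the successor's series has coefficients
`clean g`, `g = dv i p (bl i (clean c))`, and `g(B) = [Σ_{k≠i} B_k ≤ B_i + p] · clean c (B_i ↦ …)`
(`dv_bl_apply`). In characteristic `p` the final cleaning is invisible to every partial: `clean g`
and `g` differ at `A + e_j` only when all exponents of `A + e_j` are multiples of `p`, and then the
factor `A_j + 1` of `∂_j` vanishes in `L` (`pd_ser_step`). What is left is index bookkeeping with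
`Function.update` (`key_of_ne` for `j ≠ i`; `key_self` for `j = i`, where the Euler derivative has
coefficient `|B| · clean c (B)` (`theta_apply`) and `|B| = A_i + p + 1 ≡ A_i + 1 (mod p)`).
Mathlib only; `0 < n` is not used. [folklore]
-/

noncomputable section

set_option linter.dupNamespace false

open scoped BigOperators Classical

open Summit.ResolutionOfSingularities.ResolutionOfSingularities.Theorems.WildCones
  (clean bl ord dv tr step run ser pd jac Isol MultP mu)

namespace Summit.ResolutionOfSingularities.ResolutionOfSingularities.Theorems.JacobianBudget

namespace EulerTransform

open Summit.ResolutionOfSingularities.ResolutionOfSingularities.Theorems.WildCones.OrdPExitSurface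
  (step_eq clean_apply_of_not_dvd)
open Summit.ResolutionOfSingularities.ResolutionOfSingularities.Theorems.WildCones.HighOrdNotIsol
  (sum_erase_update sum_update)

variable {p n : ℕ} {L : Type} [Field L]

/-! ## Generic facts on the calculus (general `n`) -/

/-- The zero translation is the identity: in the sum defining `tr n L i 0 s g B` only `D = 0`
survives (a factor `0 ^ (D j)` with `D j ≠ 0`, `j ≠ i`, kills every other term). [folklore] -/
theorem tr_zero (i : Fin n) (s : ℕ) (g : (Fin n → ℕ) → L) : tr n L i 0 s g = g := by
  funext B
  unfold tr
  rw [Finset.sum_eq_single (0 : Fin n → ℕ)]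
  · rw [if_pos (show (0 : Fin n → ℕ) i = 0 from rfl), add_zero,
      Finset.prod_eq_one (fun j _ => ?_), mul_one]
    rw [Pi.zero_apply, Pi.zero_apply, add_zero, Nat.choose_self, Nat.cast_one, pow_zero, mul_one]
  · intro D _ hD0
    by_cases hDi : D i = 0
    · obtain ⟨j, hj⟩ : ∃ j, D j ≠ 0 := not_forall.mp (fun h => hD0 (funext h))
      have hji : j ≠ i := fun h => hj (by rw [h]; exact hDi)
      rw [if_pos hDi, Finset.prod_eq_zero (Finset.mem_erase.mpr ⟨hji, Finset.mem_univ j⟩)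
        (by rw [Pi.zero_apply, zero_pow hj, mul_zero]), mul_zero]
    · rw [if_neg hDi]
  · intro h
    exact absurd (by simp [Fintype.mem_piFinset]) h

/-- Cleaning is idempotent. [folklore] -/
theorem clean_clean (c : (Fin n → ℕ) → L) : clean p n L (clean p n L c) = clean p n L c := by
  funext A
  unfold clean
  split_ifs <;> rfl

/-- Coefficients of the divided total transform `dv i s (bl i a)`: at `B` it reads `a` at
`B` with the `i`-th exponent replaced by `B i + s - Σ_{k ≠ i} B k`, if `Σ_{k ≠ i} B k ≤ B i + s`,
and is `0` otherwise. [folklore] -/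
theorem dv_bl_apply (i : Fin n) (s : ℕ) (a : (Fin n → ℕ) → L) (B : Fin n → ℕ) :
    dv n L i s (bl n L i a) B =
      if (Finset.univ.erase i).sum (fun k => B k) ≤ B i + s then
        a (Function.update B i (B i + s - (Finset.univ.erase i).sum (fun k => B k))) else 0 := by
  simp only [dv, bl, Function.update_self, Function.update_idem, sum_erase_update]

/-! ## The two index computations -/

/-- **Bookkeeping for `j ≠ i`.** For `1 ≤ s`:
`(A j + 1) · (dv i s (bl i a)) (A + e_j) = dv i (s - 1) (bl i (B ↦ (B j + 1) · a (B + e_j))) (A)`: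
both sides read `a` at the same exponent under the same (equivalent) side condition. [folklore] -/
theorem key_of_ne {i j : Fin n} (hji : j ≠ i) (s : ℕ) (hs : 1 ≤ s) (a : (Fin n → ℕ) → L)
    (A : Fin n → ℕ) :
    ((A j + 1 : ℕ) : L) * dv n L i s (bl n L i a) (A + Pi.single j 1) =
      dv n L i (s - 1) (bl n L i fun B => ((B j + 1 : ℕ) : L) * a (B + Pi.single j 1)) A := by
  rw [dv_bl_apply, dv_bl_apply]
  have hsum : (Finset.univ.erase i).sum (fun k => (A + Pi.single j 1 : Fin n → ℕ) k) =
      (Finset.univ.erase i).sum (fun k => A k) + 1 := by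
    simp only [Pi.add_apply]
    rw [Finset.sum_add_distrib, Finset.sum_pi_single',
      if_pos (Finset.mem_erase.mpr ⟨hji, Finset.mem_univ j⟩)]
  have hi : (A + Pi.single j 1 : Fin n → ℕ) i = A i := by
    rw [Pi.add_apply, Pi.single_eq_of_ne hji.symm, add_zero]
  rw [hsum, hi]
  by_cases hle : (Finset.univ.erase i).sum (fun k => A k) + 1 ≤ A i + s
  · have hle' : (Finset.univ.erase i).sum (fun k => A k) ≤ A i + (s - 1) := by omega
    rw [if_pos hle, if_pos hle', Function.update_of_ne hji]
    congr 2
    funext k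
    by_cases hki : k = i
    · subst hki
      rw [Function.update_self, Pi.add_apply, Function.update_self, Pi.single_eq_of_ne hji.symm]
      omega
    · rw [Function.update_of_ne hki, Pi.add_apply, Pi.add_apply, Function.update_of_ne hki]
  · have hle' : ¬ (Finset.univ.erase i).sum (fun k => A k) ≤ A i + (s - 1) := by omega
    rw [if_neg hle, if_neg hle', mul_zero]

/-- **Bookkeeping for `j = i`.** If `(s : L) = 0` (characteristic dividing `s`):
`(A i + 1) · (dv i s (bl i a)) (A + e_i) = dv i (s + 1) (bl i (B ↦ |B| · a B)) (A)`: both sides read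
`a` at the same exponent `Â` under the same side condition, and `|Â| = A i + s + 1 = A i + 1` in `L`.
[folklore] -/
theorem key_self (i : Fin n) (s : ℕ) (hs : (s : L) = 0) (a : (Fin n → ℕ) → L) (A : Fin n → ℕ) :
    ((A i + 1 : ℕ) : L) * dv n L i s (bl n L i a) (A + Pi.single i 1) =
      dv n L i (s + 1) (bl n L i fun B => ((Finset.univ.sum fun k => B k : ℕ) : L) * a B) A := by
  rw [dv_bl_apply, dv_bl_apply]
  have hsum : (Finset.univ.erase i).sum (fun k => (A + Pi.single i 1 : Fin n → ℕ) k) =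
      (Finset.univ.erase i).sum (fun k => A k) :=
    Finset.sum_congr rfl fun k hk => by
      rw [Pi.add_apply, Pi.single_eq_of_ne (Finset.ne_of_mem_erase hk), add_zero]
  have hi : (A + Pi.single i 1 : Fin n → ℕ) i = A i + 1 := by
    rw [Pi.add_apply, Pi.single_eq_same]
  rw [hsum, hi]
  by_cases hle : (Finset.univ.erase i).sum (fun k => A k) ≤ A i + 1 + s
  · have hle' : (Finset.univ.erase i).sum (fun k => A k) ≤ A i + (s + 1) := by omega
    rw [if_pos hle, if_pos hle', sum_update]
    have hupd : Function.update (A + Pi.single i 1) i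
        (A i + 1 + s - (Finset.univ.erase i).sum (fun k => A k)) =
        Function.update A i (A i + (s + 1) - (Finset.univ.erase i).sum (fun k => A k)) := by
      funext k
      by_cases hki : k = i
      · subst hki
        rw [Function.update_self, Function.update_self]
        omega
      · rw [Function.update_of_ne hki, Function.update_of_ne hki, Pi.add_apply,
          Pi.single_eq_of_ne hki, add_zero]
    rw [hupd]
    congr 1
    have h : A i + (s + 1) - (Finset.univ.erase i).sum (fun k => A k) +
        (Finset.univ.erase i).sum (fun k => A k) = (A i + 1) + s := by omega
    rw [h, Nat.cast_add (A i + 1) s, hs, add_zero]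
  · have hle' : ¬ (Finset.univ.erase i).sum (fun k => A k) ≤ A i + (s + 1) := by omega
    rw [if_neg hle, if_neg hle', mul_zero]

/-! ## The successor's partials and the Euler derivative, coefficientwise -/

/-- **Characteristic `p` kills the final cleaning under `∂`.** Under `MultP c`, the `j`-th partial of
the series of the axis successor `step i 0 c` has coefficient `(A j + 1) · g (A + e_j)` at `A`, where
`g = dv i p (bl i (clean c))` is the successor BEFORE its final cleaning: `clean g` and `g` differ at
`A + e_j` only if every exponent of `A + e_j` is a multiple of `p`, and then `A j + 1 = 0` in `L`.
[folklore] -/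
theorem pd_ser_step [CharP L p] {c : (Fin n → ℕ) → L} (hM : MultP p n L c) (i j : Fin n)
    (A : Fin n →₀ ℕ) :
    pd n L j (ser p n L (step p n L i 0 c)) A =
      ((A j + 1 : ℕ) : L) * dv n L i p (bl n L i (clean p n L c)) (⇑A + Pi.single j 1) := by
  show ((A j + 1 : ℕ) : L) * clean p n L (step p n L i 0 c) ⇑(A + Finsupp.single j 1 : Fin n →₀ ℕ) = _
  rw [step_eq i 0 hM, tr_zero, clean_clean, Finsupp.coe_add, Finsupp.single_eq_pi_single]
  by_cases hall : ∀ l, p ∣ (⇑A + Pi.single j 1 : Fin n → ℕ) l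
  · have h0 : ((A j + 1 : ℕ) : L) = 0 := by
      rw [CharP.cast_eq_zero_iff L p]
      have h := hall j
      rwa [Pi.add_apply, Pi.single_eq_same] at h
    rw [h0, zero_mul, zero_mul]
  · obtain ⟨l, hl⟩ := not_forall.mp hall
    rw [clean_apply_of_not_dvd _ _ l hl]

/-- **The Euler derivative, coefficientwise**: `θa = Σ_j u_j ∂_j a` has coefficient `|B| · a_B`
(`a = ser c`, `a_B = clean c (B)`). [folklore] -/
theorem theta_apply (c : (Fin n → ℕ) → L) (B : Fin n →₀ ℕ) :
    (∑ j, MvPowerSeries.X j * pd n L j (ser p n L c) : MvPowerSeries (Fin n) L) B =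
      ((∑ j, B j : ℕ) : L) * clean p n L c ⇑B := by
  show MvPowerSeries.coeff B (∑ j, MvPowerSeries.X j * pd n L j (ser p n L c)) = _
  rw [map_sum, Nat.cast_sum, Finset.sum_mul]
  refine Finset.sum_congr rfl fun j _ => ?_
  rw [MvPowerSeries.X_def, MvPowerSeries.coeff_monomial_mul]
  by_cases hj : B j = 0
  · have h : ¬ Finsupp.single j 1 ≤ B := by rw [Finsupp.single_le_iff]; omega
    rw [if_neg h, hj, Nat.cast_zero, zero_mul]
  · have h1 : 1 ≤ B j := Nat.one_le_iff_ne_zero.mpr hj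
    have hle : Finsupp.single j 1 ≤ B := Finsupp.single_le_iff.mpr h1
    rw [if_pos hle, one_mul]
    show (((B - Finsupp.single j 1 : Fin n →₀ ℕ) j + 1 : ℕ) : L) *
        clean p n L c ⇑(B - Finsupp.single j 1 + Finsupp.single j 1 : Fin n →₀ ℕ) = _
    rw [tsub_add_cancel_of_le hle, Finsupp.tsub_apply, Finsupp.single_eq_same,
      Nat.sub_add_cancel h1]

end EulerTransform

open EulerTransform in
/-- **Stub S3 — the Euler transform identity.** In characteristic `p`, for a state `c` of
multiplicity `p` and the axis successor of chart `i` (`τ = 0`): for `j ≠ i` the `j`-th partial of the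
successor's series is the `(p-1)`-controlled transform of `∂_j a`, and the `i`-th partial is the
`(p+1)`-controlled transform of the Euler derivative `θa = Σ_j u_j ∂_j a` (`a = ser c`). Coefficient
bookkeeping: `pd_ser_step` (characteristic `p` kills the final cleaning), `key_of_ne`, `key_self`,
`theta_apply`. The hypothesis `0 < n` is not used. [folklore] -/
theorem stub_eulerTransform :
    ∀ p : ℕ, p.Prime → ∀ n : ℕ, 0 < n → ∀ (L : Type) [Field L] [CharP L p]
      (c : (Fin n → ℕ) → L) (i : Fin n), MultP p n L c →
      (∀ j, j ≠ i →
        pd n L j (ser p n L (step p n L i 0 c)) =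
          show MvPowerSeries (Fin n) L from fun A : Fin n →₀ ℕ =>
            dv n L i (p - 1) (bl n L i (fun B => pd n L j (ser p n L c) (Finsupp.equivFunOnFinite.symm B))) ⇑A) ∧
      pd n L i (ser p n L (step p n L i 0 c)) =
        show MvPowerSeries (Fin n) L from fun A : Fin n →₀ ℕ =>
          dv n L i (p + 1) (bl n L i (fun B => (∑ j, MvPowerSeries.X j * pd n L j (ser p n L c) : MvPowerSeries (Fin n) L)
            (Finsupp.equivFunOnFinite.symm B))) ⇑A := by
  intro p hp n _ L _ _ c i hM
  refine ⟨fun j hji => ?_, ?_⟩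
  · -- `j ≠ i`: the `(p-1)`-controlled transform of `∂_j a`
    have hfun : (fun B : Fin n → ℕ => pd n L j (ser p n L c) (Finsupp.equivFunOnFinite.symm B)) =
        fun B => ((B j + 1 : ℕ) : L) * clean p n L c (B + Pi.single j 1) := by
      funext B
      show (((Finsupp.equivFunOnFinite.symm B) j + 1 : ℕ) : L) *
          clean p n L c ⇑(Finsupp.equivFunOnFinite.symm B + Finsupp.single j 1 : Fin n →₀ ℕ) = _
      rw [Finsupp.coe_add, Finsupp.coe_equivFunOnFinite_symm, Finsupp.single_eq_pi_single]
    funext A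
    show pd n L j (ser p n L (step p n L i 0 c)) A =
      dv n L i (p - 1) (bl n L i fun B => pd n L j (ser p n L c) (Finsupp.equivFunOnFinite.symm B)) ⇑A
    rw [pd_ser_step hM, hfun]
    exact key_of_ne hji p hp.one_le _ _
  · -- `j = i`: the `(p+1)`-controlled transform of the Euler derivative
    have hfun : (fun B : Fin n → ℕ => (∑ j, MvPowerSeries.X j * pd n L j (ser p n L c) :
        MvPowerSeries (Fin n) L) (Finsupp.equivFunOnFinite.symm B)) =
        fun B => ((Finset.univ.sum fun k => B k : ℕ) : L) * clean p n L c B := by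
      funext B
      rw [theta_apply, Finsupp.coe_equivFunOnFinite_symm]
    funext A
    show pd n L i (ser p n L (step p n L i 0 c)) A =
      dv n L i (p + 1) (bl n L i fun B => (∑ j, MvPowerSeries.X j * pd n L j (ser p n L c) :
        MvPowerSeries (Fin n) L) (Finsupp.equivFunOnFinite.symm B)) ⇑A
    rw [pd_ser_step hM, hfun]
    exact key_self i p (CharP.cast_eq_zero L p) _ _

end Summit.ResolutionOfSingularities.ResolutionOfSingularities.Theorems.JacobianBudget

end
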